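import Literature.Analysis.FluidPDE.PeriodicLerayTransport
import Literature.Analysis.FluidPDE.CaloricLocalLerayLp
import Literature.Analysis.FluidPDE.WeakSpatialGradientSum
import HarnessLib

/-!
# [BT1] §4 ¶1–3, the transport of suitable periodic weak solutions, II: weak spatial gradients

Analysis/FluidPDE file, second part of the discharge of the named fact
`Literature.Analysis.FluidPDE.bradshawTsai2017_ansatz_transport` (`PeriodicLeraySystem.lean`;
Bradshaw–Tsai, Ann. Henri Poincaré 18 (2017) = arXiv:1510.07504 [BT1], §4, proof of Thm 1.2).
[BT1] §4 ¶2: "Note `v − e^{tΔ}v₀ ∈ L^∞(1,λ²;L²(ℝ³)) ∩ L²(1,λ²;H¹(ℝ³))`" — the `H¹` half is the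
statement that the physical image `v = u(y,s)/√(2t)` of a profile with a weak spatial gradient
`∇_y u` has the weak spatial gradient `∇_x v = (2t)⁻¹ (∇_y u)(y,s)` on the slab `t > 0`, square
integrable over `(1,λ²) × ℝ³` when `∇_y(u − U₀) ∈ L²((0,T) × ℝ³)`, `T = log λ`. This file proves:

* `BradshawTsai2017.physGradient G (t,x) = (2t)⁻¹ G(σ(t), x/√(2t))` (definition) and
  **`HasWeakSpatialGradientOn ⊤ w G → HasWeakSpatialGradientOn (slab t>0) (physVelocity w)
  (physGradient G)`** (`hasWeakSpatialGradientOn_physVelocity`): in the defining identity tested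
  with `φ ∈ C_c^∞((0,∞) × ℝ³)` one substitutes `(t,x) = Φ(s,y)` (`dt dx = e^{5s} ds dy`,
  toolkit `SimilarityVariables`) and tests the hypothesis with `e^{3s} φ ∘ Φ ∈ C_c^∞(ℝ × ℝ³)`;
* **weak spatial gradients of time-periodic fields are a.e. periodic**
  (`HasWeakSpatialGradientOn.ae_eq_comp_add_of_periodic`, by a.e. uniqueness of weak gradients,
  `HasWeakSpatialGradientOn.ae_eq`), and the **window bound**
  `∫⁻_{(a,a+T)×E} f ≤ 2 ∫⁻_{(0,T)×E} f` for `f ≥ 0` a.e. invariant under the shifts `s ↦ s + kT`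
  (`setLIntegral_Ioo_prod_le_two_mul_of_ae_periodic`);
* the clause `IsAnsatzSolution.gradient_sub_heat` (`IsSuitablePeriodicWeakSolution.gradient_sub_heat_phys`):
  with `U₀ = similarityProfile v₀ ∈ C¹` (Assumption 2.1), `∇(u − U₀) = G − DU₀` is a weak gradient
  of the `T`-periodic `u − U₀` on `ℝ × ℝ³`, its physical image is a weak gradient of
  `v − e^{tΔ}v₀` on the slab, and `∫∫_{(1,λ²)×ℝ³} |∇(v − e^{tΔ}v₀)|² = ∫∫ eˢ |∇(u − U₀)|² dy ds`
  over the period window `(σ(1), σ(1)+T)`, at most `2e^{σ(λ²)}` times the integral over `(0,T)`.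

## References

* Z. Bradshaw, T.-P. Tsai, Ann. Henri Poincaré 18 (2017) = arXiv:1510.07504, §4 (proof of
  Thm 1.2) [BradshawTsai2017AHP].
* L. C. Evans, *Partial differential equations*, §5.2.1 (weak derivatives) [Evans2010].
-/

noncomputable section

open MeasureTheory TopologicalSpace Set Function Filter Topology Module Metric
open scoped InnerProductSpace RealInnerProductSpace ENNReal NNReal

namespace Literature.Analysis.FluidPDE

/-! ### Weak gradients of time-periodic fields; the window bound -/

section Periodic

variable {E : Type*} [NormedAddCommGroup E] [InnerProductSpace ℝ E] [FiniteDimensional ℝ E]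
  [MeasurableSpace E] [BorelSpace E]

omit [FiniteDimensional ℝ E] [MeasurableSpace E] [BorelSpace E] in
/-- The time translation `(s, y) ↦ (t₀ + s, y)` pulls `⊤` back to `⊤`. [folklore] -/
theorem stPreimage_one_one_top (t₀ : ℝ) : stPreimage 1 1 t₀ (0 : E) (⊤ : Opens (ℝ × E)) = ⊤ :=
  TopologicalSpace.Opens.ext (by simp [coe_stPreimage])

/-- **Weak spatial gradients of time-periodic fields are a.e. periodic.** If `G` is a weak spatial
gradient of `w` on `ℝ × E` and `w(s + T, y) = w(s, y)`, then `G(s + T, y) = G(s, y)` for a.e.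
`(s, y)` (`G(· + T, ·)` is again a weak gradient of `w(· + T, ·) = w`, and weak gradients are
a.e. unique; Evans, *PDE*, §5.2.1). [folklore] -/
theorem HasWeakSpatialGradientOn.ae_eq_comp_add_of_periodic {w : ℝ → E → E}
    {G : ℝ → E → E →L[ℝ] E} (h : HasWeakSpatialGradientOn (⊤ : Opens (ℝ × E)) w G) {T : ℝ}
    (hw : ∀ s y, w (s + T) y = w s y) :
    ∀ᵐ z : ℝ × E ∂volume, G (z.1 + T) z.2 = G z.1 z.2 := by
  have h1 := h.stRescale 1 one_pos one_pos T (0 : E)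
  rw [stPreimage_one_one_top] at h1
  have hw' : (1 : ℝ) • stPull 1 1 T (0 : E) w = w := by
    funext s y
    rw [smul_stPull_apply, one_smul, one_mul, zero_add, one_smul, add_comm, hw]
  rw [hw'] at h1
  have h2 := h.ae_eq h1
  rw [TopologicalSpace.Opens.coe_top, Measure.restrict_univ] at h2
  filter_upwards [h2] with z hz
  have e : uncurry ((1 * 1 : ℝ) • stPull 1 1 T (0 : E) G) z = G (z.1 + T) z.2 := by
    show ((1 * 1 : ℝ) • stPull 1 1 T (0 : E) G) z.1 z.2 = G (z.1 + T) z.2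
    rw [Pi.smul_apply, Pi.smul_apply, stPull_apply, mul_one, one_smul, one_mul, zero_add, one_smul,
      add_comm]
  rw [← e, ← hz]
  rfl

omit [NormedAddCommGroup E] [InnerProductSpace ℝ E] [FiniteDimensional ℝ E] [MeasurableSpace E]
  [BorelSpace E] in
/-- Pointwise `T`-periodicity in time gives `kT`-periodicity for every `k ∈ ℤ`. [folklore] -/
theorem periodic_int_mul_of_periodic {X : Type*} {w : ℝ → X → E} {T : ℝ}
    (hw : ∀ s y, w (s + T) y = w s y) (k : ℤ) (s : ℝ) (y : X) : w (s + k * T) y = w s y := by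
  have hp : Function.Periodic (fun s => w s y) T := fun s => hw s y
  exact hp.int_mul k s

omit [FiniteDimensional ℝ E] [MeasurableSpace E] [BorelSpace E] in
/-- The time translation by `t₀` pulls the window `(t₀ + a, t₀ + b] × E` back to `(a, b] × E`. [folklore] -/
theorem stAffine_one_one_preimage_Ioc_prod (t₀ a b : ℝ) :
    stAffine 1 1 t₀ (0 : E) ⁻¹' (Ioc (t₀ + a) (t₀ + b) ×ˢ (univ : Set E)) = Ioc a b ×ˢ univ := by
  ext ⟨s, y⟩
  simp [stAffine_apply, mem_Ioc]

/-- **Translation of a window for an a.e. shift-invariant integrand**: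
`∫⁻_{(jT, jT+T] × E} f = ∫⁻_{(0, T] × E} f` if `f(s + jT, y) = f(s, y)` a.e. [folklore] -/
theorem setLIntegral_Ioc_prod_shift_eq {f : ℝ × E → ℝ≥0∞} {T : ℝ} (j : ℤ)
    (hf : (fun z : ℝ × E => f (z.1 + j * T, z.2)) =ᵐ[volume] f) :
    ∫⁻ z in Ioc (j * T) (j * T + T) ×ˢ (univ : Set E), f z = ∫⁻ z in Ioc 0 T ×ˢ (univ : Set E), f z := by
  have h1 := setLIntegral_preimage_comp_stAffine one_pos one_pos (j * T) (0 : E) f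
    (Ioc (j * T + 0) (j * T + T) ×ˢ (univ : Set E))
  rw [stAffine_one_one_preimage_Ioc_prod, add_zero, one_mul, one_pow, inv_one, ENNReal.ofReal_one,
    one_mul] at h1
  rw [← h1]
  refine setLIntegral_congr_fun_ae (measurableSet_Ioc.prod MeasurableSet.univ) ?_
  filter_upwards [hf] with z hz _
  rw [stAffine_apply, one_mul, zero_add, one_smul, add_comm]
  exact hz

/-- **Window bound for a.e. shift-invariant nonnegative fields**: if `f(s + kT, y) = f(s, y)` a.e.
for every `k ∈ ℤ` (`T > 0`), then `∫⁻_{(a, a+T] × E} f ≤ 2 ∫⁻_{(0,T) × E} f` for every `a` (the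
window lies in two consecutive translates of `(0, T]`). [folklore] -/
theorem setLIntegral_Ioc_prod_le_two_mul_of_ae_periodic {f : ℝ × E → ℝ≥0∞} {T : ℝ} (hT : 0 < T)
    (hf : ∀ k : ℤ, (fun z : ℝ × E => f (z.1 + k * T, z.2)) =ᵐ[volume] f) (a : ℝ) :
    ∫⁻ z in Ioc a (a + T) ×ˢ (univ : Set E), f z ≤ 2 * ∫⁻ z in Ioo 0 T ×ˢ (univ : Set E), f z := by
  set k : ℤ := ⌊a / T⌋ with hk
  have hk1 : (k : ℝ) * T ≤ a := by
    have := Int.floor_le (a / T); rwa [le_div_iff₀ hT] at this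
  have hk2 : a < (k + 1 : ℝ) * T := by
    have := Int.lt_floor_add_one (a / T); rwa [div_lt_iff₀ hT] at this
  have hsub : Ioc a (a + T) ×ˢ (univ : Set E) ⊆
      (Ioc ((k : ℝ) * T) ((k : ℝ) * T + T) ×ˢ (univ : Set E)) ∪
        (Ioc (((k + 1 : ℤ) : ℝ) * T) (((k + 1 : ℤ) : ℝ) * T + T) ×ˢ (univ : Set E)) := by
    rintro ⟨s, y⟩ ⟨⟨hs1, hs2⟩, -⟩
    by_cases hs : s ≤ (k : ℝ) * T + T
    · exact Or.inl ⟨⟨lt_of_le_of_lt hk1 hs1, hs⟩, mem_univ _⟩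
    · refine Or.inr ⟨⟨?_, ?_⟩, mem_univ _⟩
      · push_cast; linarith
      · push_cast; nlinarith
  have hIoo : ∫⁻ z in Ioo 0 T ×ˢ (univ : Set E), f z = ∫⁻ z in Ioc 0 T ×ˢ (univ : Set E), f z := by
    refine setLIntegral_congr ?_
    rw [Measure.volume_eq_prod]
    exact Measure.set_prod_ae_eq Ioo_ae_eq_Ioc (ae_eq_refl _)
  calc ∫⁻ z in Ioc a (a + T) ×ˢ (univ : Set E), f z
      ≤ ∫⁻ z in (Ioc ((k : ℝ) * T) ((k : ℝ) * T + T) ×ˢ (univ : Set E)) ∪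
          (Ioc (((k + 1 : ℤ) : ℝ) * T) (((k + 1 : ℤ) : ℝ) * T + T) ×ˢ (univ : Set E)), f z :=
        lintegral_mono_set hsub
    _ ≤ (∫⁻ z in Ioc ((k : ℝ) * T) ((k : ℝ) * T + T) ×ˢ (univ : Set E), f z) +
          ∫⁻ z in Ioc (((k + 1 : ℤ) : ℝ) * T) (((k + 1 : ℤ) : ℝ) * T + T) ×ˢ (univ : Set E), f z :=
        lintegral_union_le _ _ _
    _ = 2 * ∫⁻ z in Ioo 0 T ×ˢ (univ : Set E), f z := by
        rw [setLIntegral_Ioc_prod_shift_eq k (hf k), setLIntegral_Ioc_prod_shift_eq (k + 1) (hf _),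
          hIoo, two_mul]

/-- The window bound for open windows `(a, a+T) × E`. [folklore] -/
theorem setLIntegral_Ioo_prod_le_two_mul_of_ae_periodic {f : ℝ × E → ℝ≥0∞} {T : ℝ} (hT : 0 < T)
    (hf : ∀ k : ℤ, (fun z : ℝ × E => f (z.1 + k * T, z.2)) =ᵐ[volume] f) (a : ℝ) :
    ∫⁻ z in Ioo a (a + T) ×ˢ (univ : Set E), f z ≤ 2 * ∫⁻ z in Ioo 0 T ×ˢ (univ : Set E), f z :=
  (lintegral_mono_set (Set.prod_mono Ioo_subset_Ioc_self Subset.rfl)).trans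
    (setLIntegral_Ioc_prod_le_two_mul_of_ae_periodic hT hf a)

/-- **Finiteness over any number of periods**: `∫⁻_{(a, a + mT] × E} f < ∞` for every `m ∈ ℕ`
when `∫⁻_{(0,T) × E} f < ∞` and `f` is a.e. invariant under the shifts `s ↦ s + kT`. [folklore] -/
theorem setLIntegral_Ioc_prod_lt_top_of_ae_periodic {f : ℝ × E → ℝ≥0∞} {T : ℝ} (hT : 0 < T)
    (hf : ∀ k : ℤ, (fun z : ℝ × E => f (z.1 + k * T, z.2)) =ᵐ[volume] f)
    (hfin : ∫⁻ z in Ioo 0 T ×ˢ (univ : Set E), f z < ∞) (a : ℝ) (m : ℕ) :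
    ∫⁻ z in Ioc a (a + m * T) ×ˢ (univ : Set E), f z < ∞ := by
  induction m with
  | zero => simp
  | succ m ih =>
    have hsplit : Ioc a (a + (m + 1 : ℕ) * T) ×ˢ (univ : Set E) ⊆
        (Ioc a (a + m * T) ×ˢ (univ : Set E)) ∪ (Ioc (a + m * T) (a + m * T + T) ×ˢ (univ : Set E)) := by
      rintro ⟨s, y⟩ ⟨⟨hs1, hs2⟩, -⟩
      by_cases hs : s ≤ a + m * T
      · exact Or.inl ⟨⟨hs1, hs⟩, mem_univ _⟩
      · refine Or.inr ⟨⟨lt_of_not_ge hs, ?_⟩, mem_univ _⟩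
        push_cast at hs2; linarith
    refine lt_of_le_of_lt (lintegral_mono_set hsplit) ?_
    refine lt_of_le_of_lt (lintegral_union_le _ _ _) ?_
    refine ENNReal.add_lt_top.2 ⟨ih, ?_⟩
    exact lt_of_le_of_lt (setLIntegral_Ioc_prod_le_two_mul_of_ae_periodic hT hf _)
      (ENNReal.mul_lt_top (by simp) hfin)

/-- **Finiteness over bounded time sets**: `∫⁻_S f < ∞` for every `S ⊆ [a, b] × E` under the
same hypotheses (`f` locally integrable in time, uniformly in the window). [folklore] -/
theorem setLIntegral_lt_top_of_ae_periodic_of_subset_Icc_prod {f : ℝ × E → ℝ≥0∞} {T : ℝ}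
    (hT : 0 < T) (hf : ∀ k : ℤ, (fun z : ℝ × E => f (z.1 + k * T, z.2)) =ᵐ[volume] f)
    (hfin : ∫⁻ z in Ioo 0 T ×ˢ (univ : Set E), f z < ∞) {S : Set (ℝ × E)} {a b : ℝ}
    (hS : S ⊆ Icc a b ×ˢ (univ : Set E)) : ∫⁻ z in S, f z < ∞ := by
  obtain ⟨m, hm⟩ := exists_nat_gt ((b - a + 1) / T)
  have hm' : b < (a - 1) + m * T := by
    rw [div_lt_iff₀ hT] at hm; linarith
  have hsub : S ⊆ Ioc (a - 1) ((a - 1) + m * T) ×ˢ (univ : Set E) := fun z hz =>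
    ⟨⟨by linarith [(hS hz).1.1], by linarith [(hS hz).1.2]⟩, mem_univ _⟩
  exact lt_of_le_of_lt (lintegral_mono_set hsub)
    (setLIntegral_Ioc_prod_lt_top_of_ae_periodic hT hf hfin (a - 1) m)

end Periodic

namespace BradshawTsai2017

/-- Local notation for physical space `ℝ³ = EuclideanSpace ℝ (Fin 3)`. -/
local notation "ℝ³" => EuclideanSpace ℝ (Fin 3)

/-! ### The physical image of a weak spatial gradient -/

/-- **The ansatz for gradients** ([BT1] §4: `∇_x v(x,t) = (2t)⁻¹ (∇_y u)(y,s)` for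
`v = u(y,s)/√(2t)`, `y = x/√(2t)`): the physical image `(2t)⁻¹ G(σ(t), x/√(2t))` of a
(weak) spatial gradient `G` of a profile, for `t > 0`; junk value `0` for `t ≤ 0`. [cite: BradshawTsai2017AHP, §4 (proof of Thm 1.2)] -/
def physGradient (G : ℝ → ℝ³ → ℝ³ →L[ℝ] ℝ³) (t : ℝ) (x : ℝ³) : ℝ³ →L[ℝ] ℝ³ :=
  if 0 < t then (2 * t)⁻¹ • G (simTimeInv t) ((Real.sqrt (2 * t))⁻¹ • x) else 0

/-- Unfolding `physGradient` for `t > 0`. [folklore] -/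
theorem physGradient_of_pos (G : ℝ → ℝ³ → ℝ³ →L[ℝ] ℝ³) {t : ℝ} (ht : 0 < t) (x : ℝ³) :
    physGradient G t x = (2 * t)⁻¹ • G (simTimeInv t) ((Real.sqrt (2 * t))⁻¹ • x) := by
  simp only [physGradient, if_pos ht]

/-- **The gradient ansatz through `Φ`**: `(physGradient G)(Φ(s,y)) = e^{-2s} G(s,y)`. [cite: BradshawTsai2017AHP, §4 (proof of Thm 1.2)] -/
theorem physGradient_simMap (G : ℝ → ℝ³ → ℝ³ →L[ℝ] ℝ³) (s : ℝ) (y : ℝ³) :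
    physGradient G (simTime s) (Real.exp s • y) = (Real.exp (2 * s))⁻¹ • G s y := by
  rw [physGradient_of_pos G (simTime_pos s), sqrt_two_mul_simTime, simTimeInv_simTime, smul_smul,
    inv_mul_cancel₀ (Real.exp_pos s).ne', one_smul, two_mul_simTime]

/-- The uncurried gradient ansatz on the slab: `(2t)⁻¹ • G(Φ⁻¹ z)`. [folklore] -/
theorem uncurry_physGradient_of_pos (G : ℝ → ℝ³ → ℝ³ →L[ℝ] ℝ³) {z : ℝ × ℝ³} (hz : 0 < z.1) :
    uncurry (physGradient G) z = (2 * z.1)⁻¹ • uncurry G (simInv z) := by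
  obtain ⟨t, x⟩ := z
  exact physGradient_of_pos G hz x

/-- Local integrability on an open set depends only on the values on the set. [folklore] -/
theorem locallyIntegrableOn_congr_eqOn {F : Type*} [NormedAddCommGroup F] {g g' : ℝ × ℝ³ → F}
    {Q : Opens (ℝ × ℝ³)} (h : LocallyIntegrableOn g (Q : Set (ℝ × ℝ³)) volume)
    (heq : EqOn g g' (Q : Set (ℝ × ℝ³))) : LocallyIntegrableOn g' (Q : Set (ℝ × ℝ³)) volume := by
  refine locallyIntegrableOn_opens_iff.2 fun K hK hKc => ?_
  exact (locallyIntegrableOn_opens_iff.1 h K hK hKc).congr_fun (heq.mono hK) hKc.measurableSet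

/-- **Local integrability of the ansatz velocity on the slab** from local integrability of the
profile on `ℝ × ℝ³` (change of variables on compact subsets of the slab). [folklore] -/
theorem locallyIntegrableOn_uncurry_physVelocity {w : ℝ → ℝ³ → ℝ³}
    (hw : LocallyIntegrable (uncurry w) volume) :
    LocallyIntegrableOn (uncurry (physVelocity w))
      ((slab ℝ³ (Ioi 0) isOpen_Ioi : Opens (ℝ × ℝ³)) : Set (ℝ × ℝ³)) volume := by
  have hc : ContinuousOn (fun z : ℝ × ℝ³ => (Real.sqrt (2 * z.1))⁻¹) (Ioi (0 : ℝ) ×ˢ univ) := by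
    refine ContinuousOn.inv₀ (by fun_prop) fun z hz => ?_
    exact (Real.sqrt_pos.2 (by nlinarith [mem_Ioi.1 (mem_prod.1 hz).1])).ne'
  have h := locallyIntegrableOn_slab_smul_comp_simInv hw hc
  rw [coe_slab]
  exact locallyIntegrableOn_congr_eqOn (Q := slab ℝ³ (Ioi 0) isOpen_Ioi) h fun z hz =>
    (uncurry_physVelocity_of_pos w (mem_prod.1 hz).1).symm

/-- **Local integrability of the gradient ansatz on the slab.** [folklore] -/
theorem locallyIntegrableOn_uncurry_physGradient {G : ℝ → ℝ³ → ℝ³ →L[ℝ] ℝ³}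
    (hG : LocallyIntegrable (uncurry G) volume) :
    LocallyIntegrableOn (uncurry (physGradient G))
      ((slab ℝ³ (Ioi 0) isOpen_Ioi : Opens (ℝ × ℝ³)) : Set (ℝ × ℝ³)) volume := by
  have hc : ContinuousOn (fun z : ℝ × ℝ³ => (2 * z.1)⁻¹) (Ioi (0 : ℝ) ×ˢ univ) := by
    refine ContinuousOn.inv₀ (by fun_prop) fun z hz => ?_
    nlinarith [mem_Ioi.1 (mem_prod.1 hz).1]
  have h := locallyIntegrableOn_slab_smul_comp_simInv hG hc
  rw [coe_slab]
  exact locallyIntegrableOn_congr_eqOn (Q := slab ℝ³ (Ioi 0) isOpen_Ioi) h fun z hz =>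
    (uncurry_physGradient_of_pos G (mem_prod.1 hz).1).symm

/-- The pulled-back, `e^{3s}`-weighted test function `(s,y) ↦ e^{3s} φ(Φ(s,y))` used to test the
profile (its `y`-derivative absorbs the Jacobian `e^{5s}` against `e^{-s}` from `v` and `e^{-s}`
from `∇_x = e^{-s}∇_y`). Its slice derivative. [folklore] -/
theorem fderiv_exp_mul_simPull (φ : ℝ → ℝ³ → ℝ)
    (hφ : IsSpaceTimeTestOn (slab ℝ³ (Ioi 0) isOpen_Ioi) φ) (a s : ℝ) (y v : ℝ³) :
    fderiv ℝ (fun y' => Real.exp (a * s) • simPull φ s y') y v =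
      Real.exp (a * s) * Real.exp s * fderiv ℝ (φ (simTime s)) (Real.exp s • y) v := by
  have hd : DifferentiableAt ℝ (simPull φ s) y :=
    ((hφ.simPull.contDiff_slice s).differentiable (by simp)).differentiableAt
  rw [fderiv_fun_const_smul hd, FunLike.coe_smul, Pi.smul_apply, fderiv_simPull,
    FunLike.coe_smul, Pi.smul_apply, smul_eq_mul, smul_eq_mul, mul_assoc]

/-- **The physical image of a weak spatial gradient is a weak spatial gradient of the physical
image of the field** ([BT1] §4 ¶2, the `H¹` class of `v − e^{tΔ}v₀`): if `G = ∇_y w` weakly on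
`ℝ × ℝ³`, then `physGradient G = ∇_x (physVelocity w)` weakly on the slab `t > 0`. Testing with
`φ ∈ C_c^∞((0,∞) × ℝ³)` and substituting `(t,x) = Φ(s,y)`: both sides of the identity for `v`
become the identity for `w` tested with `e^{3s} φ ∘ Φ`. [cite: BradshawTsai2017AHP, §4 (proof of Thm 1.2)] -/
theorem hasWeakSpatialGradientOn_physVelocity {w : ℝ → ℝ³ → ℝ³} {G : ℝ → ℝ³ → ℝ³ →L[ℝ] ℝ³}
    (h : HasWeakSpatialGradientOn (⊤ : Opens (ℝ × ℝ³)) w G) :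
    HasWeakSpatialGradientOn (slab ℝ³ (Ioi 0) isOpen_Ioi) (physVelocity w) (physGradient G) where
  locallyIntegrableOn := locallyIntegrableOn_uncurry_physVelocity
    (locallyIntegrableOn_univ.1 (by simpa using h.locallyIntegrableOn))
  locallyIntegrableOn_grad := locallyIntegrableOn_uncurry_physGradient
    (locallyIntegrableOn_univ.1 (by simpa using h.locallyIntegrableOn_grad))
  integral_fderiv_mul_inner_eq φ hφ v w' := by
    -- the weighted pulled-back test function
    set φt : ℝ → ℝ³ → ℝ := fun s y => Real.exp (3 * s) • simPull φ s y with hφt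
    have hφt' : IsSpaceTimeTestOn (⊤ : Opens (ℝ × ℝ³)) φt :=
      hφ.time_smul_simPull (Real.contDiff_exp.comp (contDiff_const.mul contDiff_id))
    have hid := h.integral_fderiv_mul_inner_eq φt hφt' v w'
    -- the two physical integrands vanish for `t ≤ 0`
    set F₁ : ℝ → ℝ³ → ℝ := fun t x => fderiv ℝ (φ t) x v * ⟪physVelocity w t x, w'⟫ with hF₁
    set F₂ : ℝ → ℝ³ → ℝ := fun t x => φ t x * ⟪physGradient G t x v, w'⟫ with hF₂
    have hF₁0 : ∀ t ≤ (0 : ℝ), ∀ x, F₁ t x = 0 := fun t ht x => by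
      simp only [hF₁, hφ.slice_eq_zero_of_nonpos ht, fderiv_zero, Pi.zero_apply, zero_apply,
        zero_mul]
    have hF₂0 : ∀ t ≤ (0 : ℝ), ∀ x, F₂ t x = 0 := fun t ht x => by
      simp only [hF₂, hφ.eq_zero_of_nonpos ht, zero_mul]
    -- pointwise identities after the change of variables
    have key1 : ∀ s : ℝ, ∀ y : ℝ³,
        (simDensity ℝ³ (s, y) : ℝ) • F₁ (simTime s) (Real.exp s • y) =
          fderiv ℝ (φt s) y v * ⟪w s y, w'⟫ := by
      intro s y
      simp only [hF₁, hφt]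
      rw [physVelocity_simMap, fderiv_exp_mul_simPull φ hφ 3 s y v, coe_simDensity_three,
        real_inner_smul_left, smul_eq_mul]
      have e : Real.exp (5 * s) = Real.exp (3 * s) * Real.exp s * Real.exp s := by
        rw [← Real.exp_add, ← Real.exp_add]; congr 1; ring
      rw [e]
      field_simp
    have key2 : ∀ s : ℝ, ∀ y : ℝ³,
        (simDensity ℝ³ (s, y) : ℝ) • F₂ (simTime s) (Real.exp s • y) =
          φt s y * ⟪G s y v, w'⟫ := by
      intro s y
      simp only [hF₂, hφt, simPull_apply]
      rw [physGradient_simMap, coe_simDensity_three, FunLike.coe_smul, Pi.smul_apply,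
        real_inner_smul_left, smul_eq_mul, smul_eq_mul]
      have e : Real.exp (5 * s) = Real.exp (3 * s) * Real.exp (2 * s) := by
        rw [← Real.exp_add]; congr 1; ring
      rw [e]
      field_simp
    calc ∫ t, ∫ x, fderiv ℝ (φ t) x v * ⟪physVelocity w t x, w'⟫
        = ∫ s, ∫ y, (simDensity ℝ³ (s, y) : ℝ) • F₁ (simTime s) (Real.exp s • y) :=
          integral_integral_eq_simMap F₁ hF₁0
      _ = ∫ s, ∫ y, fderiv ℝ (φt s) y v * ⟪w s y, w'⟫ := by simp_rw [key1]
      _ = -∫ s, ∫ y, φt s y * ⟪G s y v, w'⟫ := hid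
      _ = -∫ s, ∫ y, (simDensity ℝ³ (s, y) : ℝ) • F₂ (simTime s) (Real.exp s • y) := by
          simp_rw [key2]
      _ = -∫ t, ∫ x, φ t x * ⟪physGradient G t x v, w'⟫ := by
          rw [integral_integral_eq_simMap F₂ hF₂0]

/-- The Frobenius weight of the transported gradient: `e^{5s} |e^{-2s} L|² = eˢ |L|²`. [folklore] -/
theorem simDensity_mul_frobeniusNormSq_physGradient (G : ℝ → ℝ³ → ℝ³ →L[ℝ] ℝ³) (z : ℝ × ℝ³) :
    (simDensity ℝ³ z : ℝ≥0∞) *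
        ENNReal.ofReal (frobeniusNormSq (physGradient G (simMap z).1 (simMap z).2)) =
      ENNReal.ofReal (Real.exp z.1) * ENNReal.ofReal (frobeniusNormSq (G z.1 z.2)) := by
  obtain ⟨s, y⟩ := z
  rw [simMap_apply, physGradient_simMap, frobeniusNormSq_smul, ← ENNReal.ofReal_coe_nnreal,
    coe_simDensity_three, ← ENNReal.ofReal_mul (Real.exp_pos _).le,
    ← ENNReal.ofReal_mul (Real.exp_pos _).le, ← mul_assoc]
  congr 2
  simp only
  rw [inv_pow, ← Real.exp_nat_mul, ← Real.exp_neg, ← Real.exp_add]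
  congr 1
  push_cast
  ring

/-! ### The clause `gradient_sub_heat` -/

/-- **The slice derivative of a `C¹` profile** as a space–time field:
`DU₀(s, y) = D(uncurry U₀)(s,y) ∘ (0, ·)`; it is the Fréchet derivative of the slice, jointly
continuous. [folklore] -/
theorem hasFDerivAt_slice_of_contDiff {U₀ : ℝ → ℝ³ → ℝ³} (hU : ContDiff ℝ 1 (uncurry U₀)) (s : ℝ)
    (y : ℝ³) :
    HasFDerivAt (U₀ s)
      ((fderiv ℝ (uncurry U₀) (s, y)).comp (ContinuousLinearMap.inr ℝ ℝ ℝ³)) y :=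
  hasFDerivAt_slice ((hU.differentiable one_ne_zero) (s, y)).hasFDerivAt

/-- Joint continuity of the slice derivative field of a `C¹` profile. [folklore] -/
theorem continuous_slice_fderiv_of_contDiff {U₀ : ℝ → ℝ³ → ℝ³} (hU : ContDiff ℝ 1 (uncurry U₀)) :
    Continuous fun z : ℝ × ℝ³ => fderiv ℝ (U₀ z.1) z.2 := by
  have h1 : (fun z : ℝ × ℝ³ => fderiv ℝ (U₀ z.1) z.2) =
      fun z => (fderiv ℝ (uncurry U₀) z).comp (ContinuousLinearMap.inr ℝ ℝ ℝ³) := by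
    funext z
    exact (hasFDerivAt_slice_of_contDiff hU z.1 z.2).fderiv
  rw [h1]
  exact ((ContinuousLinearMap.compL ℝ ℝ³ (ℝ × ℝ³) ℝ³).flip (ContinuousLinearMap.inr ℝ ℝ ℝ³)).continuous.comp
    (hU.continuous_fderiv one_ne_zero)

/-- **A `C¹` profile has its classical slice derivative as weak spatial gradient on `ℝ × ℝ³`**, and
so does its negative (the tree's `hasWeakSpatialGradientOn_of_hasFDerivAt`). [folklore] -/
theorem hasWeakSpatialGradientOn_neg_of_contDiff {U₀ : ℝ → ℝ³ → ℝ³} (hU : ContDiff ℝ 1 (uncurry U₀)) :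
    HasWeakSpatialGradientOn (⊤ : Opens (ℝ × ℝ³)) (fun s y => -U₀ s y)
      (fun s y => -fderiv ℝ (U₀ s) y) := by
  refine hasWeakSpatialGradientOn_of_hasFDerivAt (S := univ) (by simp) ?_ ?_ fun s _ y => ?_
  · exact (hU.continuous.neg).continuousOn
  · exact (continuous_slice_fderiv_of_contDiff hU).neg.continuousOn
  · have h := hasFDerivAt_slice_of_contDiff hU s y
    show HasFDerivAt (fun y => -U₀ s y) (-fderiv ℝ (U₀ s) y) y
    rw [h.fderiv]
    exact h.neg

/-- A.e. invariance of a function of an a.e. periodic gradient under the shifts `s ↦ s + kT`. [folklore] -/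
theorem ae_shift_invariant_of_weakGradient {w : ℝ → ℝ³ → ℝ³} {G : ℝ → ℝ³ → ℝ³ →L[ℝ] ℝ³}
    (h : HasWeakSpatialGradientOn (⊤ : Opens (ℝ × ℝ³)) w G) {T : ℝ}
    (hw : ∀ s y, w (s + T) y = w s y) (g : (ℝ³ →L[ℝ] ℝ³) → ℝ≥0∞) (k : ℤ) :
    (fun z : ℝ × ℝ³ => g (G (z.1 + k * T) z.2)) =ᵐ[volume] fun z => g (G z.1 z.2) := by
  filter_upwards [h.ae_eq_comp_add_of_periodic (T := k * T)
    (fun s y => periodic_int_mul_of_periodic hw k s y)] with z hz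
  rw [hz]

/-- **The clause `IsAnsatzSolution.gradient_sub_heat`** ([BT1] §4 ¶2–3: "`v − e^{tΔ}v₀ ∈ …
L²(1,λ²;H¹(ℝ³))`"): under Assumption 2.1 for `U₀ = similarityProfile v₀` (only `C¹` and
`T`-periodicity are used) and for a suitable periodic weak solution `(u, p)` with period
`T = log λ`, the field `v − e^{tΔ}v₀` (`v = physVelocity u`) has a weak spatial gradient on the
slab `t > 0` which is square integrable over `(1, λ²) × ℝ³`: namely the physical image of
`∇(u − U₀) = G − DU₀`, with `∫∫_{(1,λ²)×ℝ³} |∇(v − e^{tΔ}v₀)|² = ∫∫_{(σ(1),σ(1)+T)×ℝ³} eˢ|G − DU₀|²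
≤ 2 e^{σ(λ²)} ∫∫_{(0,T)×ℝ³} |G − DU₀|² < ∞`. [cite: BradshawTsai2017AHP, §4 (proof of Thm 1.2)] -/
theorem IsSuitablePeriodicWeakSolution.gradient_sub_heat_phys {c : ℝ} (hc : 1 < c) {v₀ : ℝ³ → ℝ³}
    {q : ℝ≥0∞} (hA : ProfileAssumption (Real.log c) q (similarityProfile v₀))
    {u : ℝ → ℝ³ → ℝ³} {p : ℝ → ℝ³ → ℝ}
    (hS : IsSuitablePeriodicWeakSolution (Real.log c) (similarityProfile v₀) u p) :
    ∃ G' : ℝ → ℝ³ → ℝ³ →L[ℝ] ℝ³,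
      HasWeakSpatialGradientOn (slab ℝ³ (Ioi 0) isOpen_Ioi)
        (fun t x => physVelocity u t x - UnboundedOperators.heatExtension v₀ t x) G' ∧
      ∫⁻ z in Ioo (1 : ℝ) (c ^ 2) ×ˢ (univ : Set ℝ³),
        ENNReal.ofReal (frobeniusNormSq (G' z.1 z.2)) < ⊤ := by
  have hc0 : 0 < c := zero_lt_one.trans hc
  have hT : 0 < Real.log c := Real.log_pos hc
  have hc2 : 0 < c ^ 2 := by positivity
  set U₀ := similarityProfile v₀ with hU₀
  obtain ⟨G, hG, hGL2, -, -⟩ := hS.weakForm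
  -- the weak gradient of `w = u − U₀` on `ℝ × ℝ³`
  set w : ℝ → ℝ³ → ℝ³ := fun s y => u s y - U₀ s y with hw
  set Gw : ℝ → ℝ³ → ℝ³ →L[ℝ] ℝ³ := fun s y => G s y - fderiv ℝ (U₀ s) y with hGw
  have hGw' : HasWeakSpatialGradientOn (⊤ : Opens (ℝ × ℝ³)) w Gw := by
    have h1 := hG.add (hasWeakSpatialGradientOn_neg_of_contDiff hA.contDiff)
    have e1 : (fun t x => u t x + -U₀ t x) = w := by
      funext t x; show u t x + -U₀ t x = u t x - U₀ t x; rw [sub_eq_add_neg]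
    have e2 : (fun t x => G t x + -fderiv ℝ (U₀ t) x) = Gw := by
      funext t x; show G t x + -fderiv ℝ (U₀ t) x = G t x - fderiv ℝ (U₀ t) x; rw [sub_eq_add_neg]
    rwa [e1, e2] at h1
  have hwper : ∀ s y, w (s + Real.log c) y = w s y := fun s y => by
    show u (s + Real.log c) y - U₀ (s + Real.log c) y = u s y - U₀ s y
    rw [hS.periodic, hA.periodic]
  -- its physical image
  refine ⟨physGradient Gw, ?_, ?_⟩
  · refine (hasWeakSpatialGradientOn_physVelocity hGw').congr_eqOn fun z hz => ?_
    obtain ⟨t, x⟩ := z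
    have ht : 0 < t := by simpa using hz
    show physVelocity u t x - UnboundedOperators.heatExtension v₀ t x = physVelocity w t x
    rw [physVelocity_sub_heatExtension_eq u v₀ ht]
  · -- change of variables over the window `(1, λ²)`
    set s₁ : ℝ := simTimeInv 1 with hs₁
    have hs₂ : simTimeInv (c ^ 2) = s₁ + Real.log c := by
      rw [hs₁, ← simTimeInv_sq_mul hc0 one_pos, mul_one]
    have hA' : MeasurableSet (Ioo (1 : ℝ) (c ^ 2) ×ˢ (univ : Set ℝ³)) :=
      measurableSet_Ioo.prod MeasurableSet.univ
    have hsub : Ioo (1 : ℝ) (c ^ 2) ×ˢ (univ : Set ℝ³) ∩ Ioi (0 : ℝ) ×ˢ (univ : Set ℝ³) =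
        Ioo (1 : ℝ) (c ^ 2) ×ˢ (univ : Set ℝ³) :=
      inter_eq_left.2 (prod_mono (fun t ht => lt_trans zero_lt_one ht.1) Subset.rfl)
    have hcov := setLIntegral_inter_slab_eq_simMap
      (fun z : ℝ × ℝ³ => ENNReal.ofReal (frobeniusNormSq (physGradient Gw z.1 z.2))) hA'
    rw [hsub, preimage_simMap_Ioo_prod one_pos hc2, hs₂] at hcov
    rw [hcov]
    simp_rw [simDensity_mul_frobeniusNormSq_physGradient]
    -- bound the weight, then the window bound by a.e. periodicity of `Gw`
    set M : ℝ := Real.exp (s₁ + Real.log c) with hM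
    have hper := ae_shift_invariant_of_weakGradient hGw' hwper
      (fun L => ENNReal.ofReal (frobeniusNormSq L))
    calc ∫⁻ z in Ioo s₁ (s₁ + Real.log c) ×ˢ (univ : Set ℝ³),
          ENNReal.ofReal (Real.exp z.1) * ENNReal.ofReal (frobeniusNormSq (Gw z.1 z.2))
        ≤ ∫⁻ z in Ioo s₁ (s₁ + Real.log c) ×ˢ (univ : Set ℝ³),
            ENNReal.ofReal M * ENNReal.ofReal (frobeniusNormSq (Gw z.1 z.2)) := by
          refine setLIntegral_mono' (measurableSet_Ioo.prod MeasurableSet.univ) fun z hz => ?_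
          exact mul_le_mul_left (ENNReal.ofReal_le_ofReal (Real.exp_le_exp.2 (mem_prod.1 hz).1.2.le)) _
      _ ≤ ENNReal.ofReal M * (2 * ∫⁻ z in Ioo 0 (Real.log c) ×ˢ (univ : Set ℝ³),
            ENNReal.ofReal (frobeniusNormSq (Gw z.1 z.2))) := by
          rw [lintegral_const_mul' _ _ ENNReal.ofReal_ne_top]
          exact mul_le_mul_right (setLIntegral_Ioo_prod_le_two_mul_of_ae_periodic hT hper s₁) _
      _ < ⊤ := by
          refine ENNReal.mul_lt_top ENNReal.ofReal_lt_top (ENNReal.mul_lt_top (by simp) ?_)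
          simpa only [hGw] using hGL2

end BradshawTsai2017

end Literature.Analysis.FluidPDE

end
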